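import Summits.KontsevichZagierPeriods.KontsevichZagierPeriods.Theses.UnfoldedStokes
import Summits.KontsevichZagierPeriods.KontsevichZagierPeriods.Theorems.StokesGeneration.Negative.IffSummit
import Summits.KontsevichZagierPeriods.KontsevichZagierPeriods.Theorems.UnfoldedStokesStokesGenerationLineReduction
import Literature.NumberTheory.Transcendental.KZSemiCanonicalReductionProofs

/-!
# `StokesGenerationOfPieces` (stmt-KontsevichZagierPeriods-17862) — the SPLIT GLUE of the deciding crux
`StokesGeneration` (stmt-3586), route UnfoldedStokes: crux-strategist r1 BC2 redirect (RESTATED re-audit, rule-N), 2026-08-17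

`ContinuousCubification → PlanarAreas → CubeKernelStep → StokesGeneration`, sorry-free, over the
materialised route decls (`Theses/UnfoldedStokes.lean` rev 5): the three pieces are the items
stmt-17853 `ContinuousCubification` (continuous cubification modulo the moves — geometric, no
transcendence), stmt-4990 `PlanarAreas` (shared; the 1-period layer, Huber–Wüstholz transferred;
inlined verbatim in the glue item's statement) and stmt-17854 `CubeKernelStep` (the conditional,
dimension-local transcendence input above dimension one).

Proof (an interleaved induction on the cube dimension, not a one-line seam):
* layer 1 from `PlanarAreas`: a continuous integrand on `[0,1]` of value `0` is `≡ [A] − [B]` with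
  `A, B` planar of integrand `1` (Viu-Sos' region under the graph, `KZ.exists_sub_of_isBounded`),
  `area A = area B` by soundness, and `PlanarAreas` makes `[A] − [B]` a relation;
* layer 0 by lifting to dimension 1 (`StokesGenerationLine.exists_liftCube`);
* all layers by induction on `d` with `CubeKernelStep` from `d = 1` on;
* the crux through its kernel calibration `stokesGeneration_iff_kernel` (`Negative/IffSummit`):
  `x ∈ ker eval` is `≡` one continuous closed-cube representation (`ContinuousCubification`) of
  value `0` (soundness), which is a relation by the previous point.
[Kontsevich–Zagier 2001, §1.2 Conjecture 1; Viu-Sos 2021, Cor. 2.3; Ayoub 2015, Rem. 1.2]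
-/

noncomputable section

set_option linter.dupNamespace false

namespace Summit.KontsevichZagierPeriods.KontsevichZagierPeriods.UnfoldedStokes.StokesGenerationRedirectSplit

open MeasureTheory Set
open Literature.NumberTheory.Transcendental
open Literature.NumberTheory.Transcendental.KZ
open Summit.KontsevichZagierPeriods.KontsevichZagierPeriods.Theses.UnfoldedStokes
  (StokesGeneration ContinuousCubification PlanarAreas CubeKernelStep StokesGenerationOfPieces)
open Summit.KontsevichZagierPeriods.UnfoldedStokes.StokesGenerationNegative
  (stokesGeneration_iff_kernel stokesGeneration_iff_summit)
open Summit.KontsevichZagierPeriods.KontsevichZagierPeriods.StokesGenerationLine (exists_liftCube)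

/-! ## Bookkeeping: the layers -/

/-- The closed unit cube. -/
abbrev cube (M : ℕ) : Set (Fin M → ℝ) := Set.pi Set.univ (fun _ : Fin M => Set.Icc (0:ℝ) 1)

/-- Layer `≤ d`: the kernel conjecture for ONE closed-cube representation of dimension `≤ d` with
integrand continuous on the closed cube. -/
def CubeKernelLE (d : ℕ) : Prop :=
  ∀ (M : ℕ), M ≤ d → ∀ (t : IntegralRep M), t.domain = cube M → ContinuousOn t.integrand t.domain →
    t.value = 0 → of t ∈ relations

/-- Bookkeeping. [folklore] -/
theorem isCompact_cube (M : ℕ) : IsCompact (cube M) := isCompact_univ_pi fun _ => isCompact_Icc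

/-- A continuous integrand on the closed cube is bounded there. [folklore] -/
theorem exists_abs_le_of_continuousOn {M : ℕ} (t : IntegralRep M) (htd : t.domain = cube M)
    (htc : ContinuousOn t.integrand t.domain) : ∃ B : ℝ, ∀ z ∈ t.domain, |t.integrand z| ≤ B := by
  have hK : IsCompact t.domain := htd ▸ isCompact_cube M
  obtain ⟨B, hB⟩ := (hK.image_of_continuousOn htc).isBounded.subset_closedBall 0
  refine ⟨B, fun z hz => ?_⟩
  have := hB (Set.mem_image_of_mem _ hz)
  simpa [Real.norm_eq_abs] using this

/-- Value zero of `t` from `x ∈ ker eval` and `x − [t] ∈ relations` (soundness of the moves). [folklore] -/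
theorem value_eq_zero_of_sub_mem {M : ℕ} {x : FormalRep} (hx : eval x = 0) (t : IntegralRep M)
    (hxt : x - of t ∈ relations) : t.value = 0 := by
  have h0 := relations_le_ker_eval_holds hxt
  rwa [AddMonoidHom.mem_ker, map_sub, hx, zero_sub, neg_eq_zero, eval_of] at h0

/-! ## Layer one from `PlanarAreas` (Viu-Sos' region under the graph + soundness) -/

/-- **Layer 1 from the planar 1-period layer.** A continuous integrand on `[0,1]` of value `0` is a
relation, granted `PlanarAreas`: `[t] ≡ [A] − [B]` with `A, B` planar of integrand `1`
(`KZ.exists_sub_of_isBounded`: sign splitting and the regions under the graphs, rules (1), (3)),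
`area A = area B` by soundness, and `PlanarAreas` makes `[A] − [B]` a relation. [folklore] -/
theorem layer_one_of_planarAreas (hP : PlanarAreas) (t : IntegralRep 1) (htd : t.domain = cube 1)
    (htc : ContinuousOn t.integrand t.domain) (hval : t.value = 0) : of t ∈ relations := by
  obtain ⟨B, hB⟩ := exists_abs_le_of_continuousOn t htd htc
  have hbd : Bornology.IsBounded t.domain := (htd ▸ isCompact_cube 1).isBounded
  obtain ⟨A, A', _, _, hAi, hA'i, hrel⟩ := exists_sub_of_isBounded t hbd hB
  -- soundness: area A = area A'
  have hvals : A.value = A'.value := by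
    have h0 := relations_le_ker_eval_holds hrel
    rw [AddMonoidHom.mem_ker, map_sub, map_sub, eval_of, eval_of, eval_of, hval, zero_sub,
      neg_eq_zero, sub_eq_zero] at h0
    exact h0
  have hAA' : of A - of A' ∈ relations := hP A A' hAi hA'i hvals
  have e : of t = (of t - (of A - of A')) + (of A - of A') := by abel
  rw [e]
  exact relations.add_mem hrel hAA'

/-- Layer `≤ 1` from `PlanarAreas` (dimension `0` by lifting to dimension `1`). [folklore] -/
theorem cubeKernelLE_one_of_planarAreas (hP : PlanarAreas) : CubeKernelLE 1 := by
  intro M hM t htd htc hval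
  rcases Nat.lt_or_ge M 1 with hM0 | hM1
  · -- M = 0: lift to dimension 1
    obtain rfl : M = 0 := by omega
    obtain ⟨t', ht'd, ht'i, hlift⟩ := exists_liftCube 0 1 (Nat.zero_le 1) t htd
    have ht'c : ContinuousOn t'.integrand t'.domain := by
      rw [ht'd]
      refine (continuousOn_const (c := t.integrand (fun l => (0 : ℝ)))).congr fun z hz => ?_
      rw [ht'i z hz]
      congr 1
      funext l
      exact l.elim0
    have hval' : t'.value = 0 := by
      have h0 := relations_le_ker_eval_holds hlift
      rw [AddMonoidHom.mem_ker, map_sub, eval_of, eval_of, hval, zero_sub, neg_eq_zero] at h0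
      exact h0
    have ht' : of t' ∈ relations := layer_one_of_planarAreas hP t' ht'd ht'c hval'
    have e : of t = (of t - of t') + of t' := by abel
    rw [e]
    exact relations.add_mem hlift ht'
  · obtain rfl : M = 1 := le_antisymm hM hM1
    exact layer_one_of_planarAreas hP t htd htc hval

/-! ## All layers by induction with the step -/

/-- Bookkeeping. [folklore] -/
theorem cubeKernelLE_all (hP : PlanarAreas) (hS : CubeKernelStep) : ∀ d, CubeKernelLE d := by
  intro d
  induction d with
  | zero => exact fun M hM => cubeKernelLE_one_of_planarAreas hP M (hM.trans (Nat.zero_le 1))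
  | succ d ih =>
    intro M hM t htd htc hval
    rcases Nat.lt_or_ge M (d + 1) with hlt | hge
    · exact ih M (Nat.lt_succ_iff.mp hlt) t htd htc hval
    · obtain rfl : M = d + 1 := le_antisymm hM hge
      rcases Nat.lt_or_ge d 1 with hd0 | hd1
      · obtain rfl : d = 0 := by omega
        exact cubeKernelLE_one_of_planarAreas hP 1 le_rfl t htd htc hval
      · exact hS d hd1 (fun M hM t htd htc hval => ih M hM t htd htc hval) t htd htc hval

/-! ## The assembly -/

/-- **The split glue, proved.** `ContinuousCubification → PlanarAreas → CubeKernelStep → StokesGeneration`. [folklore] -/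
theorem stokesGeneration_of_pieces (hC : ContinuousCubification) (hP : PlanarAreas)
    (hS : CubeKernelStep) : StokesGeneration := by
  rw [stokesGeneration_iff_kernel]
  intro x hx
  obtain ⟨M, t, htd, htc, hxt⟩ := hC x
  have hval : t.value = 0 := value_eq_zero_of_sub_mem hx t hxt
  have ht : of t ∈ relations := cubeKernelLE_all hP hS M M le_rfl t htd htc hval
  have e : x = (x - of t) + of t := by abel
  rw [e]
  exact relations.add_mem hxt ht

/-- **The glue item `StokesGenerationOfPieces` (stmt-17862) holds** — its statement inlines `PlanarAreas` verbatim, so this is `stokesGeneration_of_pieces` on the nose. [cite: KontsevichZagier2001, §1.2 Conjecture 1] -/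
theorem stokesGenerationOfPieces_proof : StokesGenerationOfPieces :=
  fun hC hP hS => stokesGeneration_of_pieces hC hP hS

/-- … and the summit from the three pieces (calibration `StokesGeneration ↔ KontsevichZagierPeriods`). [folklore] -/
theorem summit_of_pieces (hC : ContinuousCubification) (hP : PlanarAreas) (hS : CubeKernelStep) :
    _root_.KontsevichZagierPeriods :=
  stokesGeneration_iff_summit.mp (stokesGeneration_of_pieces hC hP hS)

end Summit.KontsevichZagierPeriods.KontsevichZagierPeriods.UnfoldedStokes.StokesGenerationRedirectSplit

end
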